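import Mathlib
import Summits.NavierStokesRegularity.NavierStokesRegularity.Theses.CoreLogGas

/-!
# Route CoreLogGas — crux A `LocallyDrivenIsTypeI` (item stmt-NavierStokesRegularity-11290):
good times of an integrable majorant

The locality hypothesis `H(M, t₀, g)` of `CoreLogGas.LocallyDrivenIsTypeI` bounds the exterior
symmetric velocity gradient at admissible deep points by a majorant `g` with
`IntegrableOn g (Ico t₀ T)`. A pointwise-in-time bound by an `L¹` function does NOT vanish after
the parabolic rescaling `t ↦ (T - t)` of a blow-up analysis — except along a sequence of *good
times*: since `(T - t)⁻¹` is not integrable at `T`, the product `g t * (T - t)` cannot stay above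
any `ε > 0` on a whole left neighbourhood of `T`. This file proves exactly that, in the form any
rescaling / compactness argument driven by `H` consumes:

* `exists_mul_sub_lt` — for every `ε > 0` and every `t₁ ∈ [t₀, T)` there is `t ∈ [t₁, T)` with
  `g t * (T - t) < ε` (so `liminf_{t → T⁻} g(t) (T - t) ≤ 0`);
* `frequently_mul_sub_lt` — the same as an `∃ᶠ t in 𝓝[<] T` statement.

Elementary (comparison with the non-integrable `(t - T)⁻¹`, Mathlib
`intervalIntegrable_sub_inv_iff`).
-/

-- the summit and its single sub-problem share the name (D-0017), as in every Theorems file here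
set_option linter.dupNamespace false

open Set Filter Topology MeasureTheory

namespace Summit.NavierStokesRegularity.NavierStokesRegularity.Theorems

namespace CoreLogGasLocallyDrivenIsTypeIGoodTimes

/-- **Good times of an integrable majorant.** If `g` is integrable on `Ico t₀ T`, then for every
`ε > 0` and every `t₁ ∈ [t₀, T)` some `t ∈ [t₁, T)` has `g t * (T - t) < ε`: otherwise
`(t - T)⁻¹`, dominated by `ε⁻¹ |g|` on `[t₁, T)`, would be integrable up to `T`, contradicting
`intervalIntegrable_sub_inv_iff`. -/
theorem exists_mul_sub_lt {g : ℝ → ℝ} {t₀ T : ℝ} (hg : IntegrableOn g (Ico t₀ T))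
    {ε : ℝ} (hε : 0 < ε) {t₁ : ℝ} (h₀₁ : t₀ ≤ t₁) (h₁T : t₁ < T) :
    ∃ t ∈ Ico t₁ T, g t * (T - t) < ε := by
  by_contra hcon
  have hge : ∀ t ∈ Ico t₁ T, ε ≤ g t * (T - t) := fun t ht =>
    le_of_not_gt fun hlt => hcon ⟨t, ht, hlt⟩
  -- `(t - T)⁻¹` is dominated by `ε⁻¹ * g` on `Ico t₁ T`
  have hg₁ : IntegrableOn g (Ico t₁ T) := hg.mono_set (Ico_subset_Ico_left h₀₁)
  have hdom : IntegrableOn (fun t : ℝ => (t - T)⁻¹) (Ico t₁ T) := by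
    refine Integrable.mono' (hg₁.const_mul ε⁻¹) ?_ ?_
    · exact (measurable_id.sub_const T).inv.aestronglyMeasurable
    · refine (ae_restrict_iff' measurableSet_Ico).2 (Eventually.of_forall fun t ht => ?_)
      have hTt : 0 < T - t := sub_pos.2 ht.2
      have hgt : ε ≤ g t * (T - t) := hge t ht
      have hgpos : 0 < g t := by
        by_contra hle
        have : g t * (T - t) ≤ 0 := mul_nonpos_of_nonpos_of_nonneg (le_of_not_gt hle) hTt.le
        linarith
      have h1 : (T - t)⁻¹ ≤ ε⁻¹ * g t := by
        rw [inv_le_iff_one_le_mul₀ hTt]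
        calc (1 : ℝ) = ε⁻¹ * ε := by field_simp
          _ ≤ ε⁻¹ * (g t * (T - t)) := by gcongr
          _ = ε⁻¹ * g t * (T - t) := by ring
      calc ‖(t - T)⁻¹‖ = (T - t)⁻¹ := by
            rw [Real.norm_eq_abs, abs_inv, abs_sub_comm, abs_of_pos hTt]
        _ ≤ ε⁻¹ * g t := h1
  -- hence interval integrable on `[t₁, T]`, contradicting the non-integrability at `T`
  have hint : IntervalIntegrable (fun t : ℝ => (t - T)⁻¹) volume t₁ T :=
    (intervalIntegrable_iff_integrableOn_Ico_of_le h₁T.le).2 hdom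
  rcases intervalIntegrable_sub_inv_iff.1 hint with h | h
  · exact absurd h h₁T.ne
  · exact h (right_mem_uIcc)

/-- **Good times, filter form.** If `g` is integrable on `Ico t₀ T` with `t₀ < T`, then for every
`ε > 0`, frequently as `t → T⁻`, `g t * (T - t) < ε`. -/
theorem frequently_mul_sub_lt {g : ℝ → ℝ} {t₀ T : ℝ} (hg : IntegrableOn g (Ico t₀ T))
    (h₀T : t₀ < T) {ε : ℝ} (hε : 0 < ε) :
    ∃ᶠ t in 𝓝[<] T, g t * (T - t) < ε := by
  rw [Filter.frequently_iff]
  intro U hU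
  obtain ⟨a, haT, haU⟩ : ∃ a < T, Ioo a T ⊆ U := by
    rcases mem_nhdsLT_iff_exists_Ioo_subset.1 hU with ⟨a, ha, hsub⟩
    exact ⟨a, ha, hsub⟩
  -- work on `[t₁, T)` with `t₁ = max t₀ (midpoint of a and T)` so that `Ico t₁ T ⊆ Ioo a T`
  set t₁ : ℝ := max t₀ ((a + T) / 2) with ht₁
  have h₀₁ : t₀ ≤ t₁ := le_max_left _ _
  have h₁T : t₁ < T := max_lt h₀T (by linarith)
  have ha₁ : a < t₁ := lt_of_lt_of_le (by linarith) (le_max_right _ _)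
  obtain ⟨t, ht, hlt⟩ := exists_mul_sub_lt hg hε h₀₁ h₁T
  exact ⟨t, haU ⟨ha₁.trans_le ht.1, ht.2⟩, hlt⟩

/-- **Registered helper stub `stub_goodTimes`** of crux A (stmt-NavierStokesRegularity-11290; a
real-analysis HELPER registered by lead c4, not one of the three composition stubs of line
`registered`): the closed form of `frequently_mul_sub_lt` — an integrable majorant `g` on `Ico t₀ T`
satisfies `g t * (T - t) < ε` frequently as `t → T⁻`, for every `ε > 0` (the only way the `L¹`
bound of `H` survives a parabolic rescaling: along good times). -/
theorem stub_goodTimes : ∀ (g : ℝ → ℝ) (t₀ T : ℝ), MeasureTheory.IntegrableOn g (Set.Ico t₀ T) → t₀ < T → ∀ ε : ℝ, 0 < ε → ∃ᶠ t in nhdsWithin T (Set.Iio T), g t * (T - t) < ε :=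
  fun _ _ _ hg h _ hε => frequently_mul_sub_lt hg h hε

/-- **Doubly good times.** Two integrable functions `g`, `h` on `Ico t₀ T` are SIMULTANEOUSLY
small against `(T - t)⁻¹` at some time of every `[t₁, T)`, `t₀ ≤ t₁ < T`: there is `t ∈ [t₁, T)` with
`g t * (T - t) < ε` and `h t * (T - t) < ε` (apply `exists_mul_sub_lt` to `|g| + |h|`). Typical use
for the locality hypothesis `H` of `CoreLogGas.LocallyDrivenIsTypeI`: `g` = the exterior-strain
majorant, `h t = ‖curl (u t)‖₂²` (integrable by the energy inequality), so that along such times both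
the rescaled exterior strain and the rescaled enstrophy `‖ω(t)‖₂² (T - t)` vanish. -/
theorem exists_mul_sub_lt₂ {g h : ℝ → ℝ} {t₀ T : ℝ} (hg : IntegrableOn g (Ico t₀ T))
    (hh : IntegrableOn h (Ico t₀ T)) {ε : ℝ} (hε : 0 < ε) {t₁ : ℝ} (h₀₁ : t₀ ≤ t₁)
    (h₁T : t₁ < T) :
    ∃ t ∈ Ico t₁ T, g t * (T - t) < ε ∧ h t * (T - t) < ε := by
  have hsum : IntegrableOn (fun t => |g t| + |h t|) (Ico t₀ T) := hg.abs.add hh.abs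
  obtain ⟨t, ht, hlt⟩ := exists_mul_sub_lt hsum hε h₀₁ h₁T
  have hTt : 0 ≤ T - t := sub_nonneg.2 ht.2.le
  refine ⟨t, ht, ?_, ?_⟩
  · calc g t * (T - t) ≤ |g t| * (T - t) := by gcongr; exact le_abs_self _
      _ ≤ (|g t| + |h t|) * (T - t) := by gcongr; exact le_add_of_nonneg_right (abs_nonneg _)
      _ < ε := hlt
  · calc h t * (T - t) ≤ |h t| * (T - t) := by gcongr; exact le_abs_self _
      _ ≤ (|g t| + |h t|) * (T - t) := by gcongr; exact le_add_of_nonneg_left (abs_nonneg _)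
      _ < ε := hlt

/-- **Doubly good times, filter form**: frequently as `t → T⁻`, both `g t * (T - t) < ε` and
`h t * (T - t) < ε`. -/
theorem frequently_mul_sub_lt₂ {g h : ℝ → ℝ} {t₀ T : ℝ} (hg : IntegrableOn g (Ico t₀ T))
    (hh : IntegrableOn h (Ico t₀ T)) (h₀T : t₀ < T) {ε : ℝ} (hε : 0 < ε) :
    ∃ᶠ t in 𝓝[<] T, g t * (T - t) < ε ∧ h t * (T - t) < ε := by
  rw [Filter.frequently_iff]
  intro U hU
  obtain ⟨a, haT, haU⟩ : ∃ a < T, Ioo a T ⊆ U := by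
    rcases mem_nhdsLT_iff_exists_Ioo_subset.1 hU with ⟨a, ha, hsub⟩
    exact ⟨a, ha, hsub⟩
  set t₁ : ℝ := max t₀ ((a + T) / 2) with ht₁
  have h₀₁ : t₀ ≤ t₁ := le_max_left _ _
  have h₁T : t₁ < T := max_lt h₀T (by linarith)
  have ha₁ : a < t₁ := lt_of_lt_of_le (by linarith) (le_max_right _ _)
  obtain ⟨t, ht, hlt⟩ := exists_mul_sub_lt₂ hg hh hε h₀₁ h₁T
  exact ⟨t, haU ⟨ha₁.trans_le ht.1, ht.2⟩, hlt⟩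

/-- **Registered helper stub `stub_goodTimesTwo`** of crux A (stmt-NavierStokesRegularity-11290; a
real-analysis HELPER registered by lead c4, not a composition stub of line `registered`): the closed
form of `frequently_mul_sub_lt₂` (doubly good times for two integrable majorants). -/
theorem stub_goodTimesTwo : ∀ (g h : ℝ → ℝ) (t₀ T : ℝ), MeasureTheory.IntegrableOn g (Set.Ico t₀ T) → MeasureTheory.IntegrableOn h (Set.Ico t₀ T) → t₀ < T → ∀ ε : ℝ, 0 < ε → ∃ᶠ t in nhdsWithin T (Set.Iio T), g t * (T - t) < ε ∧ h t * (T - t) < ε :=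
  fun _ _ _ _ hg hh h _ hε => frequently_mul_sub_lt₂ hg hh h hε

end CoreLogGasLocallyDrivenIsTypeIGoodTimes

end Summit.NavierStokesRegularity.NavierStokesRegularity.Theorems
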